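import Summits.QuantumFields.YangMills.Theorems.BalabanUVNodesN15KingModelContourPhaseRate
import HarnessLib

/-!
# BalabanUVNodes ∕ N15 — THE KING-MODEL RUNG, CURVED EDITION (PART Κ-c): TIGHTNESS OF KING's (3.72) — the two-spacing difference of the background
# dressing `U(B(Γ))` is EXACTLY first order in `η = L^{−k}` (attained, up to `1∕π`, at the block-corner point)
# (Track A, DAG node N15 = NE2; FAN-OUT v1.1 §N15 s3 «KING-MODEL RUNG … what the curved case adds»)

HONEST FRAMING.  Count-neutral (cell `pub-ymgap`, seat `pub-ymgap-dag-n15-e` g24; `--supports stmt-QuantumFields-27366 --as helper` = K3⁸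
`SpineGivenEndpointR13SepCoPHV`).  TEMPLATE LITERATURE: C. King, *The U(1) Higgs model. I. The continuum limit*, Commun. Math. Phys. **102** (1986) 649–677
[King1986], (3.72) p. 665 (verbatim in part Κ-b) — an UPPER bound `C·e·(L^kε)^{2−d∕2}·L^{−k}·p(L^kε)∕(μ₀L^kε)`; this file proves, for King's own objects of part
Κ-b (the dressing (3.46) along the nested contours (2.12) of a constant field), that the ORDER `L^{−k}` cannot be improved: a LOWER bound of the same order at an
explicit fine point.  Not printed by King (he needs only the upper bound); a model-level remark on «what the curved case adds» (the dressing's η-rate is `O(η)`,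
not `o(η)`).  NOT Bałaban's non-abelian `G(U)`; NOT a node discharge; nothing continuum ∕ ℝ⁴ ∕ OS ∕ mass-gap ∕ Clay.  0 `sorry`; standard axioms.

WHAT THIS FILE PROVES (namespace `…N15KingModelRung.Curved`, objects of part Κ-b: `kingDressing`, `tailPhase`, `kingSlicePt`).
* `norm_kingDressing_sub_eq`: the EXACT size `‖U(B(Γ^{(K+n)}_{x₀,x′})) − U(B(Γ^{(K)}_{x₀,x}))‖ = |2·sin(e·s·B(Γ^{(n)}_{x,x′})∕2)|` (unimodular phases differing by
  the tail angle; Mathlib `Complex.norm_exp_I_mul_ofReal_sub_one`).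
* `two_div_pi_mul_abs_le_abs_two_mul_sin`: Jordan's chord bound `(2∕π)|t| ≤ |2sin(t∕2)|` for `|t| ≤ π`.
* `cornerPt` (the far corner of the block `B^n(x)`: fine coordinate `L^n − 1` in one direction), `val_cornerPt`, `tailPhase_cornerPt`
  (`B(Γ^{(n)}_{x,x′}) = β(L^n − 1)L^{−(K+n)} = βη(1 − L^{−n})` for `B = βe_{x₀}`).
* ★★ **`kingDressing_gap_lower`**: for `B = βe_{x₀}`, `β, e, s ≥ 0`, `L^n ≥ 2` and the small-angle regime `e·s·β·L^{−K} ≤ π`: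
  `‖U′(x′) − U(x)‖ ≥ (1∕π)·e·s·β·L^{−K}` at the corner point — with part Κ-b's upper bound `≤ (d+1)·e·s·‖B‖_∞·L^{−K}` the rate is EXACTLY first order in `η`.

HONEST SCOPE.  A statement about King's U(1) model objects as typed in part Κ-b (constant field, `q = i`, head phase arbitrary); the small-angle hypothesis is
where (3.2)₁ puts the model (`e·s·‖B‖_∞·η ≪ 1`); no claim beyond the model.  N15 NOT discharged; counts unmoved.
Locators: [King1986] (2.10)–(2.12) p.653, (3.46) p.661, p.664 (pairing), (3.72) p.665.
-/

noncomputable section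

namespace Summit.QuantumFields.YangMills.BalabanUVNodes.N15KingModelRung.Curved

open scoped BigOperators
open Literature.MathematicalPhysics.QuantumFieldTheory.Balaban1983to89.B5Prop11Plancherel (Tor fine)
open Literature.MathematicalPhysics.QuantumFieldTheory.King1986.Torus (blockOf val_blockOf)
open Summit.QuantumFields.YangMills.BalabanUVNodes.N15KingModelRung.Contour

variable {d : ℕ} (L : ℕ) [NeZero L]

/-- the EXACT size of the two-spacing difference of the dressings: `‖U′ − U‖ = |2·sin(e·s·B(Γ^{(n)}_{x,x′})∕2)|` (unimodular phases differing by the tail angle).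
[cite: King1986, (3.72) p.665, (3.46) p.661] -/
theorem norm_kingDressing_sub_eq (K n : ℕ) (M : Fin (d + 1) → ℕ) [∀ μ, NeZero (M μ)] (e s : ℝ) (h : Tor M → ℝ) (B : Fin (d + 1) → ℝ)
    (x' : Tor (fine (L ^ (K + n)) M)) :
    ‖kingDressing L (K + n) M e s h B x' - kingDressing L K M e s h B (kingSlicePt L K n M x')‖
      = |2 * Real.sin (e * s * tailPhase L K n M B x' / 2)| := by
  unfold kingDressing
  rw [blockOf_kingSlicePt, kingContourPhase_nested]
  set a : ℝ := e * s * (h (blockOf (L ^ (K + n)) M x') + kingContourPhase L K M B (kingSlicePt L K n M x')) with ha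
  set t : ℝ := e * s * tailPhase L K n M B x' with ht
  have hsplit : e * s * (h (blockOf (L ^ (K + n)) M x') + (kingContourPhase L K M B (kingSlicePt L K n M x') + tailPhase L K n M B x')) = a + t := by
    rw [ha, ht]; ring
  rw [hsplit]
  have hfac : Complex.exp (Complex.I * ((a + t : ℝ) : ℂ)) - Complex.exp (Complex.I * (a : ℂ))
      = Complex.exp (Complex.I * (a : ℂ)) * (Complex.exp (Complex.I * (t : ℂ)) - 1) := by
    rw [mul_sub, mul_one, ← Complex.exp_add]; congr 1; push_cast; ring
  rw [hfac, norm_mul, Complex.norm_exp_I_mul_ofReal, one_mul, Complex.norm_exp_I_mul_ofReal_sub_one, Real.norm_eq_abs]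

/-- Jordan's inequality for the chord: `(2∕π)|t| ≤ |2·sin(t∕2)|` for `|t| ≤ π` (the same elementary inequality is stated, in another summit's tree and not
importable here, as `…BirBdG.abs_le_two_sin_half`; re-proved from Mathlib's `Real.mul_le_sin`). [folklore] -/
theorem two_div_pi_mul_abs_le_abs_two_mul_sin {t : ℝ} (ht : |t| ≤ Real.pi) : 2 / Real.pi * |t| ≤ |2 * Real.sin (t / 2)| := by
  have hpi : 0 < Real.pi := Real.pi_pos
  -- reduce to `0 ≤ t` by symmetry
  wlog h0 : 0 ≤ t generalizing t
  · have h := this (t := -t) (by rwa [abs_neg]) (by linarith [le_of_not_ge h0])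
    rwa [abs_neg, neg_div, Real.sin_neg, mul_neg, abs_neg] at h
  rw [abs_of_nonneg h0] at ht ⊢
  have h1 : 0 ≤ t / 2 := by linarith
  have h2 : t / 2 ≤ Real.pi / 2 := by linarith
  have hj := Real.mul_le_sin h1 h2
  have hsin : 0 ≤ Real.sin (t / 2) := Real.sin_nonneg_of_nonneg_of_le_pi h1 (by linarith)
  rw [abs_of_nonneg (by linarith)]
  calc 2 / Real.pi * t = 2 * (2 / Real.pi * (t / 2)) := by ring
    _ ≤ 2 * Real.sin (t / 2) := by linarith

/-- THE BLOCK-CORNER POINT of `T_{η′}`: fine coordinate `L^n − 1` in direction `0`, `0` elsewhere (the far corner of the block `B^n(x)` over the base point).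
[cite: King1986, (2.10) p.653, p.664 («x′ ∈ B^n(x)»)] -/
def cornerPt (K n : ℕ) (M : Fin (d + 1) → ℕ) (x0 : Fin (d + 1)) : Tor (fine (L ^ (K + n)) M) :=
  fun μ => if μ = x0 then (((L ^ n - 1 : ℕ) : ℕ) : ZMod (fine (L ^ (K + n)) M μ)) else 0

/-- its fine coordinates. [cite: King1986, (2.10) p.653] -/
theorem val_cornerPt (K n : ℕ) (M : Fin (d + 1) → ℕ) [∀ μ, NeZero (M μ)] (x0 μ : Fin (d + 1)) :
    (cornerPt L K n M x0 μ).val = if μ = x0 then L ^ n - 1 else 0 := by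
  unfold cornerPt
  split_ifs with hμ
  · rw [ZMod.val_natCast]
    apply Nat.mod_eq_of_lt
    have hL : 1 ≤ L := Nat.one_le_iff_ne_zero.mpr (NeZero.ne L)
    have hM : 1 ≤ M μ := Nat.one_le_iff_ne_zero.mpr (NeZero.ne (M μ))
    show L ^ n - 1 < L ^ (K + n) * M μ
    calc L ^ n - 1 < L ^ n := Nat.sub_lt (Nat.one_le_pow _ _ (by omega)) Nat.one_pos
      _ ≤ L ^ (K + n) := Nat.pow_le_pow_right (by omega) (by omega)
      _ ≤ L ^ (K + n) * M μ := Nat.le_mul_of_pos_right _ (by omega)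
  · exact ZMod.val_zero

/-- the tail phase at the corner point for the field `B = β·e_{x0}`: `B(Γ^{(n)}_{x,x′}) = β·(L^n − 1)·L^{−(K+n)} = β·η·(1 − L^{−n})`.
[cite: King1986, (2.12) p.653, (3.72) p.665] -/
theorem tailPhase_cornerPt (K n : ℕ) (M : Fin (d + 1) → ℕ) [∀ μ, NeZero (M μ)] (β : ℝ) (x0 : Fin (d + 1)) :
    tailPhase L K n M (fun μ => if μ = x0 then β else 0) (cornerPt L K n M x0) = ((L : ℝ) ^ (K + n))⁻¹ * (((L ^ n - 1 : ℕ) : ℕ) : ℝ) * β := by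
  unfold tailPhase
  rw [contourSum_blockContour]
  have hL : 1 ≤ L := Nat.one_le_iff_ne_zero.mpr (NeZero.ne L)
  have hterm : ∀ μ : Fin (d + 1), (((cornerPt L K n M x0 μ).val % L ^ n : ℕ) : ℝ) * (if μ = x0 then β else 0)
      = if μ = x0 then (((L ^ n - 1 : ℕ) : ℕ) : ℝ) * β else 0 := by
    intro μ
    rw [val_cornerPt]
    split_ifs with hμ
    · rw [Nat.mod_eq_of_lt (Nat.sub_lt (Nat.one_le_pow _ _ (by omega)) Nat.one_pos)]
    · rw [mul_zero]
  rw [Finset.sum_congr rfl fun μ _ => hterm μ, Finset.sum_ite_eq' Finset.univ x0, if_pos (Finset.mem_univ _)]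
  ring

/-- ★★ **TIGHTNESS OF (3.72)'s RATE `L^{−k}`**: for the constant field `B = β·e_{x0}` (`β ≥ 0`), `e·s ≥ 0`, `L^n ≥ 2` and the small-angle regime
`e·s·β·L^{−K} ≤ π`, the dressing difference at the block-corner point is `≥ (1∕π)·e·s·β·L^{−K}` — the two-spacing rate of the background dressing is
EXACTLY first order in `η = L^{−K}` (what the curved case adds is `O(η)`, not `o(η)`). [cite: King1986, (3.72) p.665, (2.12) p.653] -/
theorem kingDressing_gap_lower (K n : ℕ) (M : Fin (d + 1) → ℕ) [∀ μ, NeZero (M μ)] {e s β : ℝ} (he : 0 ≤ e) (hs : 0 ≤ s) (hβ : 0 ≤ β)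
    (hLn : 2 ≤ L ^ n) (hsmall : e * s * β * ((L : ℝ) ^ K)⁻¹ ≤ Real.pi) (h : Tor M → ℝ) (x0 : Fin (d + 1)) :
    1 / Real.pi * (e * s * β * ((L : ℝ) ^ K)⁻¹)
      ≤ ‖kingDressing L (K + n) M e s h (fun μ => if μ = x0 then β else 0) (cornerPt L K n M x0)
          - kingDressing L K M e s h (fun μ => if μ = x0 then β else 0) (kingSlicePt L K n M (cornerPt L K n M x0))‖ := by
  have hL : 1 ≤ L := Nat.one_le_iff_ne_zero.mpr (NeZero.ne L)
  have hLr : (1 : ℝ) ≤ L := by exact_mod_cast hL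
  have hL0 : (0 : ℝ) < L := by linarith
  have hLK : (0 : ℝ) < (L : ℝ) ^ K := by positivity
  have hLn0 : (0 : ℝ) < (L : ℝ) ^ n := by positivity
  rw [norm_kingDressing_sub_eq, tailPhase_cornerPt]
  -- the tail angle `t = e s β (L^n − 1) / L^{K+n}` lies in `[e s β η / 2, e s β η] ⊂ [0, π]`
  have hcast : (((L ^ n - 1 : ℕ) : ℕ) : ℝ) = (L : ℝ) ^ n - 1 := by
    rw [Nat.cast_sub (Nat.one_le_pow _ _ (by omega))]; push_cast; ring
  set t : ℝ := e * s * (((L : ℝ) ^ (K + n))⁻¹ * (((L ^ n - 1 : ℕ) : ℕ) : ℝ) * β) with htdef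
  have hLn2 : (2 : ℝ) ≤ (L : ℝ) ^ n := by exact_mod_cast hLn
  have ht_eq : t = e * s * β * ((L : ℝ) ^ K)⁻¹ * (((L : ℝ) ^ n - 1) / (L : ℝ) ^ n) := by
    rw [htdef, hcast, pow_add]; field_simp
  have hfrac_le : ((L : ℝ) ^ n - 1) / (L : ℝ) ^ n ≤ 1 := by rw [div_le_one hLn0]; linarith
  have hfrac_ge : 1 / 2 ≤ ((L : ℝ) ^ n - 1) / (L : ℝ) ^ n := by rw [le_div_iff₀ hLn0]; linarith
  have hA0 : 0 ≤ e * s * β * ((L : ℝ) ^ K)⁻¹ := by positivity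
  have ht0 : 0 ≤ t := by rw [ht_eq]; exact mul_nonneg hA0 (by linarith)
  have ht_le : t ≤ e * s * β * ((L : ℝ) ^ K)⁻¹ := by rw [ht_eq]; exact mul_le_of_le_one_right hA0 hfrac_le
  have ht_ge : e * s * β * ((L : ℝ) ^ K)⁻¹ * (1 / 2) ≤ t := by rw [ht_eq]; exact mul_le_mul_of_nonneg_left hfrac_ge hA0
  have htpi : |t| ≤ Real.pi := by rw [abs_of_nonneg ht0]; exact ht_le.trans hsmall
  have hj := two_div_pi_mul_abs_le_abs_two_mul_sin htpi
  rw [abs_of_nonneg ht0] at hj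
  have hpi : 0 < Real.pi := Real.pi_pos
  calc 1 / Real.pi * (e * s * β * ((L : ℝ) ^ K)⁻¹) = 2 / Real.pi * (e * s * β * ((L : ℝ) ^ K)⁻¹ * (1 / 2)) := by ring
    _ ≤ 2 / Real.pi * t := mul_le_mul_of_nonneg_left ht_ge (by positivity)
    _ ≤ |2 * Real.sin (t / 2)| := hj

end Summit.QuantumFields.YangMills.BalabanUVNodes.N15KingModelRung.Curved

end
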